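import Summits.QuantumFields.YangMills.Theorems.UnitScaleTiltProp8ChartDoubleBarSU2
import HarnessLib

/-!
# Route `UnitScaleTilt`, crux K1 child «MinimiserStabilityRegPr» (stmt-QuantumFields-19200), registered stub `stub_halvingStep` (H), (Φ-1) FIBRE HALF for the localised
# competitor map (LEAD ★w5-19200 g4 RULING L-1 (R1)) — **THE BLOCK FRAMES OF THE DOUBLE-BAR TOWER ARE UNITARY WITH `det = 1` ON SMALL-READABLE BLOCKS**: the `hvf`
# hypotheses of `HalvingCompetitorMapFrames.accFrames_quotient_pred` for `M₂(ℂ)ˣ`-fields — a multiplicative `eml`-stable predicate holding on, and near-flatness of, the fine bond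
# variables under a `(j+1)`-block passes to the frame `v(U̿^{(j)})(z)` of the `j`-fold double bar at that block

Cell `ym3-torus` (HUMAN RULING D-0037, YM ladder rung R3 — continuum SU(2) YM₃ on the torus is a RUNG, not the Clay problem), width seat `ym-ust-19200-w1` gen 7.
`--supports stmt-QuantumFields-19200 --as helper`; def-free, 0 sorry, standard axioms; counts toward nothing by itself.

WHY.  ✓`ChartDoubleBarSU2.pred_dbarIterU_of_reads` (★w8-19200 s2) propagates a multiplicative predicate (`∈ U(2)`, `det = 1`) from the fine bond variables to the
double-bar BOND VARIABLES `U̿^{(i)}(e)` on a read territory; its one-step engine ✓`pred_dbarAvgU` proves the same for the block FRAMES (110) internally but does not export it.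
The (Φ-1) fibre argument (✓`HalvingCompetitorMapFrames`) needs the predicate on the frames `v(U̿^{(j)}W)(z)` at the blocks `z ∈ Ω_{j+1}` (whose whole read territory lies in the
small charted region): this file exports that step (§1, the frame twin of `pred_dbarAvgU`'s `hframe`) and stacks it on `pred_dbarIterU_of_reads` ∕ ✓`norm_dbarIterU_sub_one_le_two_mul₀`
with the read territory «the `j`-blocks inside `z`» (§2), then specialises to unitarity and `det = 1` (§3).

WHAT IS PROVED (ns `…Theorems.HalvingCompetitorMapFramesSU2`; `P : Params`, `M₂(ℂ)ˣ`-valued fields, L²-operator norm).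
* §1 `pred_vframeU` — ONE block: `p` on and `s`-near-flatness (`12ℓs ≤ 1`) of the level-`j` field on the bonds inside `B(y)` ⇒ `p (v(S)(y))`.
* §2 ★ `pred_vframeU_dbarIterU` — `p` on and `s₀`-near-flatness of the FINE field on the bonds under the `(j+1)`-block `z`, budget `8·3800·ℓ²·L^{j+1}·s₀ ≤ 1` ⇒
  `p (v(U̿^{(j)}U)(z))`.
* §3 ★★ `vframeU_dbarIterU_mem_unitaryGroup`, ★★ `det_vframeU_dbarIterU_eq_one` — the two instances; `su2_pred_one∕_mul∕_inv` — the conjunction «unitary ∧ det = 1» on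
  `M₂(ℂ)ˣ` is a multiplicative inverse-closed predicate (the `p` fed to ✓`accFrames_quotient_pred`); ★★ `su2_vframeU_dbarIterU` — the conjunction instance.
HONEST SCOPE: bookkeeping over landed letters; the identification of the small-readable blocks with the `Ω_{j+1}` of the cube sequence and the smallness of the charted fields there
are the next file's; nothing of print is asserted; NOT a claim about the stub, the crux, the rung or a mass gap.

References: T. Bałaban, CMP **98** (1985) 17–51 [Balaban1985Averaging] ((89) p.31, (110) p.34, (122)–(123) p.36, Prop. 4 (134)–(135) p.38); CMP **109** (1987) 249–301
[Balaban1987RG1] ((0.3)–(0.9) pp.252–253).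
-/

set_option autoImplicit false

noncomputable section

open scoped BigOperators Matrix.Norms.L2Operator
open NormedSpace

namespace Summit.QuantumFields.YangMills.Theorems.HalvingCompetitorMapFramesSU2

open Literature.MathematicalPhysics.QuantumFieldTheory.Balaban1983to89
open T4Continuum BlockAveraging AveragingRT ExpMeanLog MatrixLog
open B10Eq27TorusAxialLog (holT)
open B5Eq118OneStroke (iterBlockOf iterBlockOf_succ iterBlockOf_zero)
open Summit.QuantumFields.YangMills.Theorems.Prop8Chart
open Summit.QuantumFields.YangMills.Theorems.Prop8ChartDoubleBar (vframeU coe_vframeU dbarIterU norm_holT_stair_sub_one_le holT_pred_of_walk pred_dbarIterU_of_reads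
  norm_dbarIterU_sub_one_le_two_mul₀ det_coe_units_inv_eq_one coe_units_inv_mem_unitaryGroup two_mul_lt_pi_of_le_third)

variable {P : Params}

/-! ## §1 One block: the frame satisfies the predicate -/

section OneBlock

variable {j : ℕ}

/-- **THE BLOCK FRAME (110) SATISFIES A MULTIPLICATIVE `eml`-STABLE PREDICATE**: if `p` holds on and the level-`j` field is within `s` of `1` on every bond with both ends
in `B(y)` (`12ℓs ≤ 1`), then `p (v(S)(y))` — `v(y)` is the `eml` of the centre staircase transporters, which stay in the block (✓`blockOf_ends_of_mem_stairWalk`), are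
products of block bonds (✓`holT_pred_of_walk`) and within `4ℓs ≤ 1∕3` of `1` (✓`norm_holT_stair_sub_one_le`).  (The frame twin of the internal `hframe` of ✓`pred_dbarAvgU`.)
[cite: Balaban1985Averaging, (110) p.34, (122)-(123) p.36; Balaban1987RG1, (0.3) p.252] -/
theorem pred_vframeU (p : Matrix (Fin 2) (Fin 2) ℂ → Prop) (h1 : p 1) (hmul : ∀ a b, p a → p b → p (a * b))
    (hinv : ∀ u : (Matrix (Fin 2) (Fin 2) ℂ)ˣ, p (u : Matrix (Fin 2) (Fin 2) ℂ) → p ((u⁻¹ : (Matrix (Fin 2) (Fin 2) ℂ)ˣ) : Matrix (Fin 2) (Fin 2) ℂ))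
    (heml : ∀ W : Idx P → Matrix (Fin 2) (Fin 2) ℂ, (∀ i, p (W i)) → (∀ i, ‖W i - 1‖ ≤ 1 / 3) → p (eml W))
    (hj : j + 1 ≤ P.m + P.K) (S : GaugeField P j (Matrix (Fin 2) (Fin 2) ℂ)ˣ) (y : Site P (j + 1)) {s : ℝ} (hs0 : 0 ≤ s)
    (hℓs : 12 * (((P.d + 2) * P.L : ℕ) : ℝ) * s ≤ 1)
    (hS : ∀ b : PBond P j, blockOf b.src = y → blockOf b.tgt = y → ‖((S b : (Matrix (Fin 2) (Fin 2) ℂ)ˣ) : Matrix (Fin 2) (Fin 2) ℂ) - 1‖ ≤ s)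
    (hp : ∀ b : PBond P j, blockOf b.src = y → blockOf b.tgt = y → p ((S b : (Matrix (Fin 2) (Fin 2) ℂ)ˣ) : Matrix (Fin 2) (Fin 2) ℂ)) :
    p ((vframeU S y : (Matrix (Fin 2) (Fin 2) ℂ)ˣ) : Matrix (Fin 2) (Fin 2) ℂ) := by
  have hℓs4 : 4 * (((P.d + 2) * P.L : ℕ) : ℝ) * s ≤ 1 := by
    have : 0 ≤ (((P.d + 2) * P.L : ℕ) : ℝ) * s := by positivity
    linarith
  have hthird : 4 * (((P.d + 2) * P.L : ℕ) : ℝ) * s ≤ 1 / 3 := by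
    have : 0 ≤ (((P.d + 2) * P.L : ℕ) : ℝ) * s := by positivity
    linarith
  have hpu : ∀ (x : Site P j) (w : List (Letter P.d)), (∀ st ∈ walk x w, p ((S st.bond : (Matrix (Fin 2) (Fin 2) ℂ)ˣ) : Matrix (Fin 2) (Fin 2) ℂ)) →
      p ((holT S x w : (Matrix (Fin 2) (Fin 2) ℂ)ˣ) : Matrix (Fin 2) (Fin 2) ℂ) := fun x w hw =>
    holT_pred_of_walk (fun u : (Matrix (Fin 2) (Fin 2) ℂ)ˣ => p (u : Matrix (Fin 2) (Fin 2) ℂ)) (by rw [Units.val_one]; exact h1)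
      (fun a b ha hb => by rw [Units.val_mul]; exact hmul _ _ ha hb) hinv S x w hw
  rw [coe_vframeU]
  refine heml _ (fun i => hpu _ _ fun st hst => hp st.bond ?_ ?_) fun i => ((norm_holT_stair_sub_one_le hj y hs0 hℓs4 hS i).1).trans hthird
  · exact (blockOf_ends_of_mem_stairWalk hj y i.1 i.2.1 st hst).1
  · exact (blockOf_ends_of_mem_stairWalk hj y i.1 i.2.1 st hst).2

end OneBlock

/-! ## §2 The frame of the `j`-fold double bar at a small-readable block -/

/-- ★ **THE FRAME OF `U̿^{(j)}U` AT A `(j+1)`-BLOCK WHOSE FINE BONDS ARE SMALL**: if `p` holds on and the fine field is within `s₀` of `1` on every fine bond with both ends under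
the `(j+1)`-block `z`, with the B2 budget `8·3800·ℓ²·L^{j+1}·s₀ ≤ 1`, then `p (v(U̿^{(j)}U)(z))` — the level-`j` double-bar field is `2Lʲs₀`-near-flat and satisfies `p` on the
`j`-bonds inside `z` (✓`norm_dbarIterU_sub_one_le_two_mul₀`, ✓`pred_dbarIterU_of_reads` with the read territory «`j`-blocks inside `z`»), then §1.
[cite: Balaban1985Averaging, Prop. 4 (134)-(135) p.38, (110) p.34; Balaban1987RG1, (0.9) p.253] -/
theorem pred_vframeU_dbarIterU (p : Matrix (Fin 2) (Fin 2) ℂ → Prop) (h1 : p 1) (hmul : ∀ a b, p a → p b → p (a * b))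
    (hinv : ∀ u : (Matrix (Fin 2) (Fin 2) ℂ)ˣ, p (u : Matrix (Fin 2) (Fin 2) ℂ) → p ((u⁻¹ : (Matrix (Fin 2) (Fin 2) ℂ)ˣ) : Matrix (Fin 2) (Fin 2) ℂ))
    (heml : ∀ W : Idx P → Matrix (Fin 2) (Fin 2) ℂ, (∀ i, p (W i)) → (∀ i, ‖W i - 1‖ ≤ 1 / 3) → p (eml W))
    {j : ℕ} (hj : j + 1 ≤ P.m + P.K) (z : Site P (j + 1)) (U : GaugeField P 0 (Matrix (Fin 2) (Fin 2) ℂ)ˣ) {s₀ : ℝ} (hs₀ : 0 ≤ s₀)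
    (hbudget : 8 * 3800 * (((P.d + 2) * P.L : ℕ) : ℝ) ^ 2 * (P.L : ℝ) ^ (j + 1) * s₀ ≤ 1)
    (hU : ∀ b : PBond P 0, iterBlockOf (j + 1) b.src = z → iterBlockOf (j + 1) b.tgt = z → ‖((U b : (Matrix (Fin 2) (Fin 2) ℂ)ˣ) : Matrix (Fin 2) (Fin 2) ℂ) - 1‖ ≤ s₀)
    (hpU : ∀ b : PBond P 0, iterBlockOf (j + 1) b.src = z → iterBlockOf (j + 1) b.tgt = z → p ((U b : (Matrix (Fin 2) (Fin 2) ℂ)ˣ) : Matrix (Fin 2) (Fin 2) ℂ)) :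
    p ((vframeU (dbarIterU j U) z : (Matrix (Fin 2) (Fin 2) ℂ)ˣ) : Matrix (Fin 2) (Fin 2) ℂ) := by
  set ℓ : ℝ := (((P.d + 2) * P.L : ℕ) : ℝ) with hℓ
  have hℓ1 : (1 : ℝ) ≤ ℓ := by
    rw [hℓ]; exact_mod_cast Nat.one_le_iff_ne_zero.mpr (Nat.mul_ne_zero (by omega) (by have := P.hL.2; omega))
  have hL1 : (1 : ℝ) ≤ P.L := by exact_mod_cast P.L_pos
  have hbudget_j : 8 * 3800 * ℓ ^ 2 * (P.L : ℝ) ^ j * s₀ ≤ 1 := by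
    refine le_trans ?_ hbudget
    have : (P.L : ℝ) ^ j ≤ (P.L : ℝ) ^ (j + 1) := pow_le_pow_right₀ hL1 (Nat.le_succ j)
    have h0 : 0 ≤ 8 * 3800 * ℓ ^ 2 * s₀ := by positivity
    nlinarith
  -- the read territory: the `j`-blocks inside `z`
  set S' : Set (Site P j) := {y | blockOf y = z} with hS'
  have hU' : ∀ b : PBond P 0, iterBlockOf j b.src ∈ S' → iterBlockOf j b.tgt ∈ S' →
      ‖((U b : (Matrix (Fin 2) (Fin 2) ℂ)ˣ) : Matrix (Fin 2) (Fin 2) ℂ) - 1‖ ≤ s₀ :=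
    fun b hs ht => hU b (by rw [iterBlockOf_succ]; exact hs) (by rw [iterBlockOf_succ]; exact ht)
  have hpU' : ∀ b : PBond P 0, iterBlockOf j b.src ∈ S' → iterBlockOf j b.tgt ∈ S' →
      p ((U b : (Matrix (Fin 2) (Fin 2) ℂ)ˣ) : Matrix (Fin 2) (Fin 2) ℂ) :=
    fun b hs ht => hpU b (by rw [iterBlockOf_succ]; exact hs) (by rw [iterBlockOf_succ]; exact ht)
  have hF : ∀ e : PBond P j, e.src ∈ S' → e.tgt ∈ S' → p ((dbarIterU j U e : (Matrix (Fin 2) (Fin 2) ℂ)ˣ) : Matrix (Fin 2) (Fin 2) ℂ) :=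
    pred_dbarIterU_of_reads p h1 hmul hinv heml j (Nat.le_of_succ_le hj) S' U s₀ hs₀ hbudget_j hU' hpU'
  have hnear : ∀ e : PBond P j, e.src ∈ S' → e.tgt ∈ S' →
      ‖((dbarIterU j U e : (Matrix (Fin 2) (Fin 2) ℂ)ˣ) : Matrix (Fin 2) (Fin 2) ℂ) - 1‖ ≤ 2 * ((P.L : ℝ) ^ j * s₀) :=
    fun e hs ht => norm_dbarIterU_sub_one_le_two_mul₀ (Nat.le_of_succ_le hj) S' U hs₀ hbudget_j hU' e hs ht
  -- the frame step needs `12ℓ·(2Lʲs₀) ≤ 1`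
  have h2x : 0 ≤ 2 * ((P.L : ℝ) ^ j * s₀) := by positivity
  have h12 : 12 * (((P.d + 2) * P.L : ℕ) : ℝ) * (2 * ((P.L : ℝ) ^ j * s₀)) ≤ 1 := by
    rw [← hℓ]
    have hx0 : 0 ≤ (P.L : ℝ) ^ j * s₀ := by positivity
    have hb' : 8 * 3800 * ℓ ^ 2 * ((P.L : ℝ) ^ j * s₀) ≤ 1 := by
      have : 8 * 3800 * ℓ ^ 2 * ((P.L : ℝ) ^ j * s₀) = 8 * 3800 * ℓ ^ 2 * (P.L : ℝ) ^ j * s₀ := by ring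
      rw [this]; exact hbudget_j
    nlinarith [mul_le_mul_of_nonneg_right hℓ1 (by positivity : (0 : ℝ) ≤ ℓ * ((P.L : ℝ) ^ j * s₀))]
  exact pred_vframeU p h1 hmul hinv heml hj (dbarIterU j U) z h2x h12 (fun b hs ht => hnear b hs ht) fun b hs ht => hF b hs ht

/-! ## §3 Unitarity and `det = 1` of the frames; the conjunction -/

/-- ★★ **THE FRAME `v(U̿^{(j)}U)(z)` IS UNITARY** when the fine field is unitary and `s₀`-near-flat under `z` (budget `8·3800·ℓ²·L^{j+1}·s₀ ≤ 1`).
[cite: Balaban1987RG1, (0.9) p.253; Balaban1985Averaging, (110) p.34] -/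
theorem vframeU_dbarIterU_mem_unitaryGroup {j : ℕ} (hj : j + 1 ≤ P.m + P.K) (z : Site P (j + 1)) (U : GaugeField P 0 (Matrix (Fin 2) (Fin 2) ℂ)ˣ)
    {s₀ : ℝ} (hs₀ : 0 ≤ s₀) (hbudget : 8 * 3800 * (((P.d + 2) * P.L : ℕ) : ℝ) ^ 2 * (P.L : ℝ) ^ (j + 1) * s₀ ≤ 1)
    (hU : ∀ b : PBond P 0, iterBlockOf (j + 1) b.src = z → iterBlockOf (j + 1) b.tgt = z → ‖((U b : (Matrix (Fin 2) (Fin 2) ℂ)ˣ) : Matrix (Fin 2) (Fin 2) ℂ) - 1‖ ≤ s₀)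
    (hun : ∀ b : PBond P 0, iterBlockOf (j + 1) b.src = z → iterBlockOf (j + 1) b.tgt = z →
      ((U b : (Matrix (Fin 2) (Fin 2) ℂ)ˣ) : Matrix (Fin 2) (Fin 2) ℂ) ∈ Matrix.unitaryGroup (Fin 2) ℂ) :
    ((vframeU (dbarIterU j U) z : (Matrix (Fin 2) (Fin 2) ℂ)ˣ) : Matrix (Fin 2) (Fin 2) ℂ) ∈ Matrix.unitaryGroup (Fin 2) ℂ :=
  pred_vframeU_dbarIterU (fun M : Matrix (Fin 2) (Fin 2) ℂ => M ∈ Matrix.unitaryGroup (Fin 2) ℂ) (Submonoid.one_mem _)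
    (fun _ _ ha hb => Submonoid.mul_mem _ ha hb) (fun _ hu => coe_units_inv_mem_unitaryGroup hu)
    (fun _ hW hs' => eml_mem_unitaryGroup hW hs') hj z U hs₀ hbudget hU hun

/-- ★★ **THE FRAME `v(U̿^{(j)}U)(z)` HAS `det = 1`** when the fine field has `det = 1` and is `s₀`-near-flat under `z` (budget `8·3800·ℓ²·L^{j+1}·s₀ ≤ 1`; `card = 2` makes
the winding guard of the series logarithm automatic). [cite: Balaban1987RG1, before (0.5) p.253; Balaban1985Averaging, (110) p.34] -/
theorem det_vframeU_dbarIterU_eq_one {j : ℕ} (hj : j + 1 ≤ P.m + P.K) (z : Site P (j + 1)) (U : GaugeField P 0 (Matrix (Fin 2) (Fin 2) ℂ)ˣ)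
    {s₀ : ℝ} (hs₀ : 0 ≤ s₀) (hbudget : 8 * 3800 * (((P.d + 2) * P.L : ℕ) : ℝ) ^ 2 * (P.L : ℝ) ^ (j + 1) * s₀ ≤ 1)
    (hU : ∀ b : PBond P 0, iterBlockOf (j + 1) b.src = z → iterBlockOf (j + 1) b.tgt = z → ‖((U b : (Matrix (Fin 2) (Fin 2) ℂ)ˣ) : Matrix (Fin 2) (Fin 2) ℂ) - 1‖ ≤ s₀)
    (hdet : ∀ b : PBond P 0, iterBlockOf (j + 1) b.src = z → iterBlockOf (j + 1) b.tgt = z → ((U b : (Matrix (Fin 2) (Fin 2) ℂ)ˣ) : Matrix (Fin 2) (Fin 2) ℂ).det = 1) :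
    ((vframeU (dbarIterU j U) z : (Matrix (Fin 2) (Fin 2) ℂ)ˣ) : Matrix (Fin 2) (Fin 2) ℂ).det = 1 :=
  pred_vframeU_dbarIterU (fun M : Matrix (Fin 2) (Fin 2) ℂ => M.det = 1) Matrix.det_one
    (fun _ _ ha hb => by rw [Matrix.det_mul, ha, hb, one_mul]) (fun _ hu => det_coe_units_inv_eq_one hu)
    (fun _ hW hs' => det_eml_eq_one hW hs' fun i' => two_mul_lt_pi_of_le_third (hs' i')) hj z U hs₀ hbudget hU hdet

/-- the conjunction «unitary with `det = 1`» holds at `1 ∈ M₂(ℂ)ˣ`. [folklore] -/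
theorem su2_pred_one : ((1 : (Matrix (Fin 2) (Fin 2) ℂ)ˣ) : Matrix (Fin 2) (Fin 2) ℂ) ∈ Matrix.unitaryGroup (Fin 2) ℂ ∧
    ((1 : (Matrix (Fin 2) (Fin 2) ℂ)ˣ) : Matrix (Fin 2) (Fin 2) ℂ).det = 1 := by
  rw [Units.val_one]; exact ⟨Submonoid.one_mem _, Matrix.det_one⟩

/-- the conjunction «unitary with `det = 1`» on `M₂(ℂ)ˣ` is closed under products. [folklore] -/
theorem su2_pred_mul (a b : (Matrix (Fin 2) (Fin 2) ℂ)ˣ)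
    (ha : (a : Matrix (Fin 2) (Fin 2) ℂ) ∈ Matrix.unitaryGroup (Fin 2) ℂ ∧ (a : Matrix (Fin 2) (Fin 2) ℂ).det = 1)
    (hb : (b : Matrix (Fin 2) (Fin 2) ℂ) ∈ Matrix.unitaryGroup (Fin 2) ℂ ∧ (b : Matrix (Fin 2) (Fin 2) ℂ).det = 1) :
    ((a * b : (Matrix (Fin 2) (Fin 2) ℂ)ˣ) : Matrix (Fin 2) (Fin 2) ℂ) ∈ Matrix.unitaryGroup (Fin 2) ℂ ∧ ((a * b : (Matrix (Fin 2) (Fin 2) ℂ)ˣ) : Matrix (Fin 2) (Fin 2) ℂ).det = 1 := by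
  rw [Units.val_mul]
  exact ⟨Submonoid.mul_mem _ ha.1 hb.1, by rw [Matrix.det_mul, ha.2, hb.2, one_mul]⟩

/-- the conjunction «unitary with `det = 1`» on `M₂(ℂ)ˣ` is closed under inversion. [folklore] -/
theorem su2_pred_inv (a : (Matrix (Fin 2) (Fin 2) ℂ)ˣ)
    (ha : (a : Matrix (Fin 2) (Fin 2) ℂ) ∈ Matrix.unitaryGroup (Fin 2) ℂ ∧ (a : Matrix (Fin 2) (Fin 2) ℂ).det = 1) :
    ((a⁻¹ : (Matrix (Fin 2) (Fin 2) ℂ)ˣ) : Matrix (Fin 2) (Fin 2) ℂ) ∈ Matrix.unitaryGroup (Fin 2) ℂ ∧ ((a⁻¹ : (Matrix (Fin 2) (Fin 2) ℂ)ˣ) : Matrix (Fin 2) (Fin 2) ℂ).det = 1 :=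
  ⟨coe_units_inv_mem_unitaryGroup ha.1, det_coe_units_inv_eq_one ha.2⟩

/-- ★★ **THE FRAME IS IN `SU(2)`** (unitary with `det = 1`) when the fine field is `SU(2)`-valued and `s₀`-near-flat under the block — the `hvf` hypothesis of
✓`HalvingCompetitorMapFrames.accFrames_quotient_pred` for the predicate «unitary ∧ det = 1». [cite: Balaban1987RG1, (0.9) p.253; Balaban1985Averaging, (110) p.34] -/
theorem su2_vframeU_dbarIterU {j : ℕ} (hj : j + 1 ≤ P.m + P.K) (z : Site P (j + 1)) (U : GaugeField P 0 (Matrix (Fin 2) (Fin 2) ℂ)ˣ)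
    {s₀ : ℝ} (hs₀ : 0 ≤ s₀) (hbudget : 8 * 3800 * (((P.d + 2) * P.L : ℕ) : ℝ) ^ 2 * (P.L : ℝ) ^ (j + 1) * s₀ ≤ 1)
    (hU : ∀ b : PBond P 0, iterBlockOf (j + 1) b.src = z → iterBlockOf (j + 1) b.tgt = z → ‖((U b : (Matrix (Fin 2) (Fin 2) ℂ)ˣ) : Matrix (Fin 2) (Fin 2) ℂ) - 1‖ ≤ s₀)
    (hsu : ∀ b : PBond P 0, iterBlockOf (j + 1) b.src = z → iterBlockOf (j + 1) b.tgt = z →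
      ((U b : (Matrix (Fin 2) (Fin 2) ℂ)ˣ) : Matrix (Fin 2) (Fin 2) ℂ) ∈ Matrix.unitaryGroup (Fin 2) ℂ ∧ ((U b : (Matrix (Fin 2) (Fin 2) ℂ)ˣ) : Matrix (Fin 2) (Fin 2) ℂ).det = 1) :
    ((vframeU (dbarIterU j U) z : (Matrix (Fin 2) (Fin 2) ℂ)ˣ) : Matrix (Fin 2) (Fin 2) ℂ) ∈ Matrix.unitaryGroup (Fin 2) ℂ ∧
      ((vframeU (dbarIterU j U) z : (Matrix (Fin 2) (Fin 2) ℂ)ˣ) : Matrix (Fin 2) (Fin 2) ℂ).det = 1 :=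
  ⟨vframeU_dbarIterU_mem_unitaryGroup hj z U hs₀ hbudget hU fun b hs ht => (hsu b hs ht).1,
    det_vframeU_dbarIterU_eq_one hj z U hs₀ hbudget hU fun b hs ht => (hsu b hs ht).2⟩

end Summit.QuantumFields.YangMills.Theorems.HalvingCompetitorMapFramesSU2

end
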